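import Summits.ResolutionOfSingularities.ResolutionOfSingularities.Theorems.PurelyInseparableDim4ResConeCInfLegality
import Summits.ResolutionOfSingularities.ResolutionOfSingularities.Theorems.PurelyInseparableDim4ResConeLightTripleMinor
import HarnessLib
import HarnessLib.Audit.Tags

/-!
# Purely inseparable four-folds — the C∞ GAME READ IN THE FRAME FOR EVERY PRIME (K24b-F3 ∀ p): LEGALITY and FLAG
# readings of a pure corner step of the light-pair power cone at `(p, p − 1)`, in res-dim4-p-9's p-free game coordinates
# (cell `res-dim4-pi`, K2(p) lane, rung 1, power-cone row «light pair (1,1) at d = p − 1»; no `7` in any signature)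

[OURS · counted 0 · cell `res-dim4-pi` · K2(p) lane (holder res-dim4-p-12 g5; exit-table row B1's light sub-row); the
`(p, d) = (5, 4)` instance is res-dim4-p-3 g3's `…ResConeCInfLegality` (K24b-F3); seat res-dim4-p-3 g5 («C∞-PRIME» FILE 1,
offered on the bus 2026-08-29 09:17Z).]  Nothing here proves K2(p) for any `p`, any TAIL(p, p−1, 3), `NoIsolatedTrap p p`, the
Cossart–Jannsen–Saito theorem or resolution of singularities in dimension ≥ 4 / characteristic `p` — NOT proved.  AI kernel
work, weaker than expert review.

WHY THIS IS p-FREE.  res-dim4-p-9 g3's C∞ game (`CInfGame.no_infinite_play`: monomials `(c, a, b, e)`, λ-step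
`a ↦ a + b + e − c`, LEGAL(λ) «no `a + 2b + 2e < 2c`», λ-FLAG «some `b + e + 1 ≤ c`», ANY family constant `c`, pigeonhole)
carries no prime.  At `(p, d)` with `d + 1 = p` the light-pair power-cone regime is: boundary `r = e_κ + e_o` (two slots of
weight `1`), `x^r ∣ F`, `ord₀ F = d + 2 = p + 1`, residual cone STRAIGHT at the free letter `f` (`resForm = a·x_f^d` after a
linear re-framing); a residual monomial is `m̃ = (a+1)e_κ + (b+1)e_o + e·e_u + (d−1−c)e_f`, `c ≤ d − 1`.  Then:
* §1 `linearForm_off_eq_zero_pow`, `coeff_powerCone_eq_zero_of_straight_pow` — a power cone `c·L^d` containing `x_f^d` and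
  no `x_f^{d−1}x_i` is `c ℓ_f^d·x_f^d` (needs `(d : K) ≠ 0`, i.e. `p ∤ d` — true for `d = p − 1`);
* §2 `chartExponent_pair_add_of_succ` — the chart law `m̃ ↦ m̃.update κ (|m̃| − d)` (= the game's `a ↦ a + b + e − c`; `d`
  cancels), `step_zero_r_of_ordZero_succ` (`r′ = r`);
* §3 **`cInf_legal_readings_of_corner_prime (p) (hdp : d + 1 = p) (hd2 : 2 ≤ d)`** — if the pure-corner child in chart `κ`
  has `ord₀ = d + 2` and `e_G = 3` again then (i) it is STRAIGHT again, (ii) `coeff_{r + d·e_f}` is carried, (iii) LEGAL(κ):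
  every parent residual monomial `m̃ ≠ d·e_f` with `d ≤ |m̃|` and `2|m̃| ≤ m̃_κ + 2d` is ABSENT — in game coordinates
  `a + 2b + 2e + 1 ≤ 2c` ⇒ absent, res-dim4-p-9's `hlegL`/`hlegM` VERBATIM for every prime;
* §4 **`cInf_flag_reading_prime (p)`** — isolation along the `l`-axis gives a present `x^{r + m̃}` with `|m̃| ≤ m̃_l + (p − 2)`,
  i.e. `b + e + 1 ≤ c`, the game's FLAG, every prime.
So «is there a window game at `(7, 6)`?» (holder's rung 0 (d), row B1): for the LIGHT sub-row, YES — the same game with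
`c ≤ p − 2`.  What remains `(5,4)`-specific in the tree is the DRESS of the other C∞ files (p-3 g3/g4 ×7, typ-1 `…Window*` ×8).

[cite: CossartJannsenSaito2020, Thm. 3.14, Lemma 13.2] [cite: HauserPerlega2019PRIMS, §2 (the blowup in the x₁-chart)]
bears_on: LADDER-RESOLUTION:D157-DOOR2 (res-dim4-pi · K2(p) · power cones · C∞ readings every prime).  Supports
stmt-ResolutionOfSingularities-16155 (helper).
-/

set_option linter.dupNamespace false -- mandated namespace of this single-conjunct summit

noncomputable section

namespace Summit.ResolutionOfSingularities.ResolutionOfSingularities.Theorems.PIDim4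

namespace ResCone

open MvPolynomial Finset
open Literature.AlgebraicGeometry.Resolution
open Literature.AlgebraicGeometry.Resolution.CentreBlowup
open Literature.AlgebraicGeometry.Resolution.Hauser2010
open Literature.AlgebraicGeometry.Resolution.HauserPerlega2019

variable {K : Type} [Field K]

/-! ## 1. A straight power cone of degree `d`, `(d : K) ≠ 0` -/

/-- **A power cone `c·L^d` that contains `x_f^d` and no `x_f^{d−1}·x_i` is a pure `d`-th power of `x_f`**: `ℓ_i = 0` for
`i ≠ f` (`coeff_{x_f^d} = c ℓ_f^d ≠ 0`, `coeff_{x_f^{d−1}x_i} = d c ℓ_f^{d−1} ℓ_i`; needs `(d : K) ≠ 0`). [folklore] -/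
theorem linearForm_off_eq_zero_pow {ℓ : Fin 4 → K} {c : K} (f : Fin 4) {d : ℕ} (hdK : (d : K) ≠ 0)
    (hc : coeff (Finsupp.single f d) (C c * (∑ i, C (ℓ i) * X i) ^ d) ≠ 0)
    (h0 : ∀ i, i ≠ f → coeff (Finsupp.single i 1 + Finsupp.single f (d - 1)) (C c * (∑ i, C (ℓ i) * X i) ^ d) = 0) :
    ∀ i, i ≠ f → ℓ i = 0 := by
  obtain ⟨n, rfl⟩ : ∃ n, d = n + 1 := ⟨d - 1, by
    have : d ≠ 0 := fun h => hdK (by rw [h, Nat.cast_zero])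
    omega⟩
  intro i hi
  rw [coeff_C_mul, coeff_single_linearFormSum_pow] at hc
  have h := h0 i hi
  rw [Nat.add_sub_cancel, coeff_C_mul, coeff_single_add_single_linearFormSum_pow hi ℓ n] at h
  have hcℓ : c ≠ 0 ∧ ℓ f ≠ 0 :=
    ⟨fun h0c => hc (by rw [h0c, zero_mul]), fun h0ℓ => hc (by rw [h0ℓ, zero_pow (Nat.succ_ne_zero n), mul_zero])⟩
  have hd' : (n + 1 : K) ≠ 0 := by exact_mod_cast hdK
  have hne : c * ((n + 1 : K) * ℓ f ^ n) ≠ 0 := mul_ne_zero hcℓ.1 (mul_ne_zero hd' (pow_ne_zero _ hcℓ.2))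
  have h' : c * ((n + 1 : K) * ℓ f ^ n) * ℓ i = 0 := by rw [← h]; ring
  exact (mul_eq_zero.mp h').resolve_left hne

/-- **All degree-`d` coefficients of a straight power cone other than `x_f^d` vanish.** [folklore] -/
theorem coeff_powerCone_eq_zero_of_straight_pow {ℓ : Fin 4 → K} {c : K} (f : Fin 4) {d : ℕ} (hdK : (d : K) ≠ 0)
    (hc : coeff (Finsupp.single f d) (C c * (∑ i, C (ℓ i) * X i) ^ d) ≠ 0)
    (h0 : ∀ i, i ≠ f → coeff (Finsupp.single i 1 + Finsupp.single f (d - 1)) (C c * (∑ i, C (ℓ i) * X i) ^ d) = 0)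
    {m : Fin 4 →₀ ℕ} (hm : m ≠ Finsupp.single f d) :
    coeff m (C c * (∑ i, C (ℓ i) * X i) ^ d) = 0 := by
  classical
  have hoff := linearForm_off_eq_zero_pow f hdK hc h0
  have hL : (∑ i, C (ℓ i) * X i : MvPolynomial (Fin 4) K) = C (ℓ f) * X f := by
    rw [← Finset.add_sum_erase _ _ (Finset.mem_univ f)]
    rw [Finset.sum_eq_zero fun i hi => by rw [hoff i (Finset.ne_of_mem_erase hi), C_0, zero_mul], add_zero]
  rw [hL, mul_pow, ← map_pow, ← mul_assoc, ← map_mul, X_pow_eq_monomial, C_mul_monomial, coeff_monomial,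
    if_neg (Ne.symm hm)]

/-! ## 2. Exponent bookkeeping for a boundary of two letters of weight `1`, order `d + 2 = p + 1` -/

/-- **The chart image of a residual monomial** over the boundary `r = e_κ + e_o` at `(p, d)`, `d + 1 = p`: for `|m̃| ≥ d`,
`chartExponent p univ κ (r + m̃) = r + m̃.update κ (|m̃| − d)` — the game's `(c, a, b, e) ↦ (c, a + b + e − c, b, e)`, no `p`.
[folklore] -/
theorem chartExponent_pair_add_of_succ (p : ℕ) {d : ℕ} (hdp : d + 1 = p) {κ o : Fin 4} (hκo : κ ≠ o)
    {r m : Fin 4 →₀ ℕ} (hr : r = Finsupp.single κ 1 + Finsupp.single o 1) (hm : d ≤ m.degree) :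
    chartExponent p Finset.univ κ (r + m) = r + m.update κ (m.degree - d) := by
  have hrκ : r κ = 1 := by rw [hr]; simp [hκo]
  have hrdeg : r.degree = 2 := by rw [hr, map_add]; simp
  rw [chartExponent_univ_eq_update]
  ext k
  by_cases hk : k = κ
  · rw [hk, Finsupp.coe_update, Function.update_self, Finsupp.add_apply, Finsupp.coe_update,
      Function.update_self, map_add, hrdeg, hrκ]
    omega
  · rw [Finsupp.coe_update, Function.update_of_ne hk, Finsupp.add_apply, Finsupp.add_apply,
      Finsupp.coe_update, Function.update_of_ne hk]

/-- **A pure corner step in the chart of a weight-`1` letter keeps the boundary vector** when `ord₀ F = p + 1`. [folklore] -/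
theorem step_zero_r_of_ordZero_succ [DecidableEq K] (p : ℕ) {κ : Fin 4} {s : State K}
    (ho : ordZero s.F = ((p + 1 : ℕ) : ℕ∞)) (hrκ : s.r κ = 1) :
    (CentreBlowup.step p Finset.univ κ 0 s).r = s.r := by
  rw [step_r_univ' p κ 0 s ho]
  ext i
  rw [Finsupp.coe_update]
  by_cases hi : i = κ
  · rw [hi, Function.update_self, hrκ]; omega
  · rw [Function.update_of_ne hi, Finsupp.filter_apply, if_pos (show (0 : Fin 4 → K) i = 0 from rfl)]

/-! ## 3. LEGALITY of a pure corner step, read in the frame, every prime -/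

section Legal

variable [DecidableEq K]

/-- **THE TRANSPORTED FRAME STRAIGHTENS THE CHILD, and LEGALITY, for every prime** (K24b-F3 ∀ p; `d + 1 = p`, `2 ≤ d`).
Pure corner step in chart `κ` of a state with boundary `r = e_κ + e_o` (weights `1`), `x^r ∣ F`, `ord₀ F = d + 2`, STRAIGHT
at the free letter `f` (`coeff_{r + d·e_f} F ≠ 0`, every other degree-`d` residual coefficient vanishes) with the Tschirnhaus
row `coeff_{r + (d−1)e_f + 2e_κ} F = 0`; if the child `s′` has `ord₀ = d + 2` and `e_G = 3` then: (i) the child is straight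
again; (ii) `coeff_{r + d·e_f}` is carried identically; (iii) LEGAL(κ): every parent residual monomial `m̃ ≠ d·e_f` with
`d ≤ |m̃|` and `2|m̃| ≤ m̃_κ + 2d` (its chart image has residual degree `≤ d`) is absent — «no κ-BLOCKER present»,
res-dim4-p-9's `hlegL`/`hlegM` with family constants `c ≤ d − 1`. [OURS · idea-4's LEGAL table, uniform form, every prime]
[cite: CossartJannsenSaito2020, Thm. 3.14] -/
theorem cInf_legal_readings_of_corner_prime (p : ℕ) [Fact p.Prime] [CharP K p] {d : ℕ} (hdp : d + 1 = p)
    (hd2 : 2 ≤ d) {κ o f : Fin 4} (hκo : κ ≠ o) (hκf : κ ≠ f) (hof : o ≠ f) {s : State K}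
    (hr : s.r = Finsupp.single κ 1 + Finsupp.single o 1)
    (hdiv : ∀ e ∈ s.F.support, s.r ≤ e) (ho : ordZero s.F = ((d + 2 : ℕ) : ℕ∞))
    (ha : coeff (s.r + Finsupp.single f d) s.F ≠ 0)
    (hstraight : ∀ m : Fin 4 →₀ ℕ, m.degree = d → m ≠ Finsupp.single f d → coeff (s.r + m) s.F = 0)
    (htsch : coeff (s.r + (Finsupp.single f (d - 1) + Finsupp.single κ 2)) s.F = 0)
    (ho' : ordZero (CentreBlowup.step p Finset.univ κ 0 s).F = ((d + 2 : ℕ) : ℕ∞))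
    (he3' : Module.finrank K (resVertex (CentreBlowup.step p Finset.univ κ 0 s)) = 3) :
    (∀ m : Fin 4 →₀ ℕ, m.degree = d → m ≠ Finsupp.single f d →
        coeff (s.r + m) (CentreBlowup.step p Finset.univ κ 0 s).F = 0) ∧
      coeff (s.r + Finsupp.single f d) (CentreBlowup.step p Finset.univ κ 0 s).F =
        coeff (s.r + Finsupp.single f d) s.F ∧
      ∀ m : Fin 4 →₀ ℕ, d ≤ m.degree → 2 * m.degree ≤ m κ + 2 * d → m ≠ Finsupp.single f d →
        coeff (s.r + m) s.F = 0 := by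
  have hp : p.Prime := Fact.out
  have hdK : (d : K) ≠ 0 := fun h => by
    have hdvd := (CharP.cast_eq_zero_iff K p d).mp h
    have := Nat.le_of_dvd (by omega) hdvd
    omega
  set s' := CentreBlowup.step p Finset.univ κ 0 s with hs'
  have hrκ : s.r κ = 1 := by rw [hr]; simp [hκo]
  have hro : s.r o = 1 := by rw [hr]; simp [hκo.symm]
  have hrf : s.r f = 0 := by rw [hr]; simp [hκf.symm, hof.symm]
  have ho1 : ordZero s.F = ((p + 1 : ℕ) : ℕ∞) := by rw [ho, show d + 2 = p + 1 by omega]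
  have hr' : s'.r = s.r := step_zero_r_of_ordZero_succ p ho1 hrκ
  have hrdeg : s.r.degree = 2 := by rw [hr, map_add]; simp
  have hdiv' : ∀ e ∈ s'.F.support, s'.r ≤ e :=
    newMult_le_of_mem_support_step p Finset.univ κ 0 rfl s ho hdiv (perm_univ ho hdiv)
  have hq : ((p : ℕ) : ℕ∞) ≤ ordAlong Finset.univ s.F := by
    rw [ordAlong_univ, ho]; exact_mod_cast (by omega : p ≤ d + 2)
  -- the chart law at residual monomials `r + m̃`, `|m̃| ≥ d`, `m̃ o ≤ d − 1` (so the image is no p-th power)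
  have hchart : ∀ m : Fin 4 →₀ ℕ, d ≤ m.degree → m o ≤ d - 1 →
      coeff (s.r + m.update κ (m.degree - d)) s'.F = coeff (s.r + m) s.F := by
    intro m hm hmo
    rw [← chartExponent_pair_add_of_succ p hdp hκo hr hm, coeff_step_zero_chartExponent p κ s hq
      (by rw [map_add, hrdeg]; omega), if_neg (not_isPthPowerExponent_of_not_dvd (i := o) ?_)]
    rw [chartExponent_pair_add_of_succ p hdp hκo hr hm, Finsupp.add_apply, hro, Finsupp.coe_update,
      Function.update_of_ne hκo.symm]
    intro hdvd
    have := Nat.le_of_dvd (by omega) hdvd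
    omega
  -- the child's residual cone and how to read the child at degree `d + 2`
  obtain ⟨ℓ', c, -, -, hform⟩ := resForm_eq_C_mul_pow_of_finrank_eq_three p ho'
    (by rw [hr', hrdeg]; omega) he3'
  rw [hr', hrdeg, show d + 2 - 2 = d from rfl] at hform
  have hread : ∀ m : Fin 4 →₀ ℕ, m.degree = d →
      coeff (s.r + m) s'.F = coeff m (C c * (∑ i, C (ℓ' i) * X i) ^ d) := by
    intro m hm
    have h := congrArg (coeff (s.r + m)) (monomial_mul_resForm hdiv')
    rw [hr', coeff_monomial_mul', if_pos le_self_add, one_mul, add_tsub_cancel_left, hform] at h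
    rw [h]
    unfold initialForm
    rw [ho', ENat.toNat_coe, coeff_homogeneousComponent, if_pos (by rw [map_add, hrdeg, hm]; ring)]
  -- (i) the child is straight: no `x_f^{d−1} x_i`
  have hchild_straight : ∀ i, i ≠ f →
      coeff (Finsupp.single i 1 + Finsupp.single f (d - 1)) (C c * (∑ i, C (ℓ' i) * X i) ^ d) = 0 := by
    intro i hi
    have hdegd : (Finsupp.single i 1 + Finsupp.single f (d - 1) : Fin 4 →₀ ℕ).degree = d := by
      rw [map_add, Finsupp.degree_single, Finsupp.degree_single]; omega
    rw [← hread _ hdegd]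
    by_cases hiκ : i = κ
    · -- preimage: the Tschirnhaus monomial `r + (d−1)e_f + 2e_κ`
      subst hiκ
      have hpre_deg : (Finsupp.single f (d - 1) + Finsupp.single i 2 : Fin 4 →₀ ℕ).degree = d + 1 := by
        rw [map_add, Finsupp.degree_single, Finsupp.degree_single]; omega
      have h := hchart (Finsupp.single f (d - 1) + Finsupp.single i 2) (by rw [hpre_deg]; omega) (by
        simp [hof, hκo.symm])
      have hupd : (Finsupp.single f (d - 1) + Finsupp.single i 2 : Fin 4 →₀ ℕ).update i
          ((Finsupp.single f (d - 1) + Finsupp.single i 2 : Fin 4 →₀ ℕ).degree - d) =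
          Finsupp.single i 1 + Finsupp.single f (d - 1) := by
        rw [hpre_deg]
        ext k; by_cases hk : k = i
        · subst hk
          simp only [Finsupp.coe_update, Function.update_self, Finsupp.add_apply, Finsupp.single_eq_same,
            Finsupp.single_eq_of_ne hκf]
          omega
        · simp [Finsupp.coe_update, Function.update_of_ne hk, Finsupp.single_apply, Ne.symm hk]
      rw [hupd] at h
      rw [h]; exact htsch
    · -- preimage: `r + (d−1)e_f + e_i` itself (its `κ`-exponent is `0`, its image has the same exponent)
      have h := hchart (Finsupp.single f (d - 1) + Finsupp.single i 1) (by
        rw [map_add, Finsupp.degree_single, Finsupp.degree_single]; omega) (by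
        simp only [Finsupp.add_apply, Finsupp.single_apply, if_neg hof.symm, zero_add]
        split_ifs <;> omega)
      have hupd : (Finsupp.single f (d - 1) + Finsupp.single i 1 : Fin 4 →₀ ℕ).update κ
          ((Finsupp.single f (d - 1) + Finsupp.single i 1 : Fin 4 →₀ ℕ).degree - d) =
          Finsupp.single i 1 + Finsupp.single f (d - 1) := by
        have hdeg' : (Finsupp.single f (d - 1) + Finsupp.single i 1 : Fin 4 →₀ ℕ).degree = d := by
          rw [map_add, Finsupp.degree_single, Finsupp.degree_single]; omega
        rw [hdeg', Nat.sub_self]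
        ext k; by_cases hk : k = κ
        · subst hk; simp [hκf, Ne.symm hiκ]
        · simp only [Finsupp.coe_update, Function.update_of_ne hk, Finsupp.add_apply]
          ring
      rw [hupd] at h
      rw [h]
      refine hstraight _ (by rw [map_add, Finsupp.degree_single, Finsupp.degree_single]; omega) fun heq => hi ?_
      have := DFunLike.congr_fun heq i
      simp [Ne.symm hi] at this
  -- (ii) the `x_f^d` coefficient is carried (`r + d·e_f` is fixed by the chart law)
  have hxd : coeff (s.r + Finsupp.single f d) s'.F = coeff (s.r + Finsupp.single f d) s.F := by
    have h := hchart (Finsupp.single f d) (by rw [Finsupp.degree_single]) (by simp [hof])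
    have hupd : (Finsupp.single f d : Fin 4 →₀ ℕ).update κ ((Finsupp.single f d : Fin 4 →₀ ℕ).degree - d) =
        Finsupp.single f d := by
      rw [Finsupp.degree_single, Nat.sub_self]
      ext k; by_cases hk : k = κ
      · subst hk; simp [hκf.symm]
      · simp [Finsupp.coe_update, Function.update_of_ne hk]
    rwa [hupd] at h
  have hcd : coeff (Finsupp.single f d) (C c * (∑ i, C (ℓ' i) * X i) ^ d) ≠ 0 := by
    rw [← hread _ (Finsupp.degree_single f d), hxd]; exact ha
  -- (i) every other degree-`d` residual coefficient of the child vanishes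
  have hzero : ∀ m : Fin 4 →₀ ℕ, m.degree = d → m ≠ Finsupp.single f d → coeff (s.r + m) s'.F = 0 :=
    fun m hm hne => by
      rw [hread m hm]; exact coeff_powerCone_eq_zero_of_straight_pow f hdK hcd hchild_straight hne
  refine ⟨hzero, hxd, fun m hmd hle hne => ?_⟩
  -- (iii) LEGAL(κ): the image of `m̃` has residual degree `≤ d`
  have hdeg' := degree_update_add m κ (m.degree - d)
  by_cases hmo : m o ≤ d - 1
  · rw [← hchart m hmd hmo]
    by_cases hd' : (m.update κ (m.degree - d)).degree = d
    · refine hzero _ hd' fun heq => hne ?_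
      -- `m̃.update κ (|m̃| − d) = d·e_f` forces `|m̃| = d`, `m̃ f = d`, hence `m̃ = d·e_f`
      have hκ0 : m.degree - d = 0 := by
        have := DFunLike.congr_fun heq κ
        rw [Finsupp.coe_update, Function.update_self, Finsupp.single_apply, if_neg (Ne.symm hκf)] at this
        exact this
      have hmf : m f = d := by
        have := DFunLike.congr_fun heq f
        rw [Finsupp.coe_update, Function.update_of_ne (Ne.symm hκf), Finsupp.single_eq_same] at this
        exact this
      exact eq_single_of_degree_eq_of_apply_eq (by omega) hmf
    · refine coeff_eq_zero_of_degree_lt_ordZero ?_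
      rw [ho', map_add, hrdeg]
      exact_mod_cast (by omega : 2 + (m.update κ (m.degree - d)).degree < d + 2)
  · -- `m̃ o ≥ d`: then `m̃ κ = 0`, `|m̃| = d`, and the parent coefficient vanishes by straightness directly
    have hκo' := degree_eq_apply_add_apply_add_degIn hκo m
    exact hstraight m (by omega) hne

end Legal

/-! ## 4. FLAG reading: isolation along a boundary axis, every prime -/

/-- **FLAG READING for every prime** (K24b-F3 ∀ p): an ISOLATED `p`-fold point whose boundary has weight `1` at the letter
`l` and total weight `2` carries a monomial `x^{r + m̃}` with `|m̃| ≤ m̃_l + (p − 2)` — for `l = λ` and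
`m̃ = (a+1)e_λ + (b+1)e_μ + e·e_u + (p−2−c)e_f` this is `b + e + 1 ≤ c`, the game's λ-FLAG.  Isolation forbids the `l`-axis
to be `p`-fold (`ordAlong_erase_lt_of_isIsolated`); the `l`-exponent of the witness is not bounded here. [OURS]
[cite: HauserPerlega2019PRIMS, §2 (permissible blowups)] -/
theorem cInf_flag_reading_prime (p : ℕ) {l : Fin 4} {s : State K} (hiso : IsIsolated p s.F)
    (hdiv : ∀ e ∈ s.F.support, s.r ≤ e) (hrl : s.r l = 1) (hrdeg : s.r.degree = 2) :
    ∃ m : Fin 4 →₀ ℕ, coeff (s.r + m) s.F ≠ 0 ∧ m.degree + 2 ≤ m l + p := by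
  obtain ⟨E, hE, hdegE⟩ := exists_degIn_lt_of_ordAlong_lt (ordAlong_erase_lt_of_isIsolated hiso l)
  obtain ⟨m, rfl⟩ : ∃ m, E = s.r + m := ⟨E - s.r, (add_tsub_cancel_of_le (hdiv E hE)).symm⟩
  refine ⟨m, MvPolynomial.mem_support_iff.mp hE, ?_⟩
  have h := degIn_erase_add_apply l (s.r + m)
  rw [Finsupp.add_apply, hrl, map_add, hrdeg] at h
  omega

end ResCone

end Summit.ResolutionOfSingularities.ResolutionOfSingularities.Theorems.PIDim4

end
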